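import Mathlib

/-!
# Isolation budget law (hsemireg-semihom-2 g19, 2026-08-30) — fibre kernel

line stmt-HodgeConjecture-18881 Cruxes/BlochSeedDiscOne/Lines/birth.lean 814a6a70c14e831a stub_rung_pad4_seedAt

Model-level linear algebra behind memo `ISOLATION-BUDGET-U2-semihom2-g19.md` (pub-hsemireg, semihom-2 g19).  A display of a monad
at a point `x` is `A --i--> N --q--> C` with `i` injective, `q` surjective, `q ∘ i = 0`; its cohomology has dimension
`dim N − dim A − dim C` (= rank E, the BUDGET).  If a subspace `W ≤ N` is q-DARK (`W ≤ ker q`) and i-UNSOURCED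
(`W ∩ im i = 0`), then `im i ⊕ W ≤ ker q`, whence

  `dim A + dim C + dim W ≤ dim N`        (`isolation_budget`),

i.e. `dim W ≤ budget`; if `dim W` exceeds the budget no display exists (`no_display_of_isolated`).
Dictionary (memo §1): `W = ⊕_y K_y(x)`, one line per copy `y` of an N-side box hosting a half letter `F_w` at position `p`
with NO ψ_p / FF source from the A-side and no FF target on the C-side, at a point `x` whose `p`-coordinate lies on the
collapse divisor of that letter (chain law of record: `im ψ = ker φ = k ⊂ F_w|x`, so `K_y = k ⊗ (other factors)` is killed by
every block out of `y` and met by no block into `y`).  So `n(x) := #{such copies collapsed at x} ≤ rank E`.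
Sibling of `B3JointHall.subMonad_of_compl` / `subMonad_finrank_le` (same kernel, stated with the dark summand explicit).
Evidence-only; CLASS tables ≠ designs ≠ sheaves ≠ SEED; nothing here is a step toward HC / HC_CM / HC_AV / №4 / 26512 / 18881 / H2.
-/
namespace Summit.HodgeConjecture.HodgeConjecture.Cruxes.BlochSeedDiscOne.IsolationBudget

open Module LinearMap

variable {K : Type*} [Field K]
variable {A N C : Type*} [AddCommGroup A] [Module K A] [AddCommGroup N] [Module K N] [AddCommGroup C] [Module K C]

/-- ISOLATION BUDGET: in a display `A --i--> N --q--> C` (`i` injective, `q` surjective, `q ∘ i = 0`) every subspace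
`W ≤ ker q` with `W ∩ im i = 0` satisfies `dim A + dim C + dim W ≤ dim N`, i.e. `dim W ≤ dim N − dim A − dim C = rank E`. -/
theorem isolation_budget [FiniteDimensional K N] (i : A →ₗ[K] N) (q : N →ₗ[K] C)
    (hi : Function.Injective i) (hq : Function.Surjective q) (h : q.comp i = 0)
    (W : Submodule K N) (hW : W ≤ LinearMap.ker q) (hdisj : Disjoint (LinearMap.range i) W) :
    finrank K A + finrank K C + finrank K W ≤ finrank K N := by
  have hle : LinearMap.range i ≤ LinearMap.ker q := by
    rintro _ ⟨a, rfl⟩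
    have := LinearMap.congr_fun h a
    simpa using this
  have hsup : LinearMap.range i ⊔ W ≤ LinearMap.ker q := sup_le hle hW
  have hinf : LinearMap.range i ⊓ W = ⊥ := hdisj.eq_bot
  have hST : finrank K ↥(LinearMap.range i ⊔ W) + finrank K ↥(LinearMap.range i ⊓ W)
      = finrank K ↥(LinearMap.range i) + finrank K ↥W :=
    Submodule.finrank_sup_add_finrank_inf_eq (LinearMap.range i) W
  have hbot : finrank K ↥(LinearMap.range i ⊓ W) = 0 := by
    rw [hinf, finrank_bot]
  have h1 : finrank K ↥(LinearMap.range i) = finrank K A := LinearMap.finrank_range_of_inj hi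
  have h2 : finrank K ↥(LinearMap.range i ⊔ W) ≤ finrank K ↥(LinearMap.ker q) := Submodule.finrank_mono hsup
  have h3 : finrank K ↥(LinearMap.range q) + finrank K ↥(LinearMap.ker q) = finrank K N :=
    LinearMap.finrank_range_add_finrank_ker q
  have h4 : finrank K ↥(LinearMap.range q) = finrank K C := by
    rw [LinearMap.range_eq_top.mpr hq, finrank_top]
  omega

/-- Contrapositive (the DEAD verdict): if a q-dark, i-unsourced subspace `W` has `dim W > dim N − dim A − dim C`
(more isolated collapsed half-letter lines than the rank budget), then `A --i--> N --q--> C` is not a display. -/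
theorem no_display_of_isolated [FiniteDimensional K N] (i : A →ₗ[K] N) (q : N →ₗ[K] C) (W : Submodule K N)
    (hW : W ≤ LinearMap.ker q) (hdisj : Disjoint (LinearMap.range i) W)
    (hbig : finrank K N < finrank K A + finrank K C + finrank K W) :
    ¬ (Function.Injective i ∧ Function.Surjective q ∧ q.comp i = 0) := by
  rintro ⟨hi, hq, h⟩
  have := isolation_budget i q hi hq h W hW hdisj
  omega

/-- The budget is attained by nothing smaller: with `W = ⊥` the law is the plain monad inequality
`dim A + dim C ≤ dim N` of `B3JointHall.subMonad_finrank_le`. -/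
theorem monad_finrank_le [FiniteDimensional K N] (i : A →ₗ[K] N) (q : N →ₗ[K] C)
    (hi : Function.Injective i) (hq : Function.Surjective q) (h : q.comp i = 0) :
    finrank K A + finrank K C ≤ finrank K N := by
  have := isolation_budget i q hi hq h ⊥ bot_le disjoint_bot_right
  simpa using this

/-- Toy instance of the DEAD verdict (budget 0, one isolated line): `A = 0`, `N = C = K`, `W = ⊤ ≤ ker q` forces `q = 0`,
so `q` is not surjective — one dark line exceeds a zero budget. -/
example (q : K →ₗ[K] K) (hW : (⊤ : Submodule K K) ≤ LinearMap.ker q) : ¬ Function.Surjective q := by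
  intro hq
  have hq0 : q = 0 := by
    ext
    have : (1 : K) ∈ LinearMap.ker q := hW Submodule.mem_top
    simpa using this
  obtain ⟨x, hx⟩ := hq 1
  simp [hq0] at hx

end Summit.HodgeConjecture.HodgeConjecture.Cruxes.BlochSeedDiscOne.IsolationBudget
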